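import Mathlib.Analysis.InnerProductSpace.Projection.Basic
import Mathlib.Analysis.InnerProductSpace.Adjoint
import HarnessLib

/-!
# Route `UnitScaleTilt`, crux K1 «MinimiserStabilityRegPr» (stmt-QuantumFields-19200), EX rows `h349` ∕ `hGF` (curved member) — **LOD LINE GLUE (★p1 g24, LOCATE-P349-CT v2 §7 (E2)):
# THE STRUCTURAL IDENTITY `(Δ·ker Q)ᗮ = (Δ + a·TQ)⁻¹(range T)` BEHIND «`P = 1 − R = B M⁻¹ Bᴴ` WITH `B = G_a Q″†`», AND THE GRAM COERCIVITY FROM A SMOOTH INTERPOLANT ((L4′)-core)**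

Cell `ym3-torus` (HUMAN RULING D-0037, YM ladder rung R3 — NOT d = 4, NOT a mass gap, NOT Clay).  Fleet lead seat `ym-ust-19200-p1` gen 24; ★★OWNER RULINGS №33∕№34.  THEOREMS ONLY
(0 `def`, 0 `sorry`), Mathlib only, carrier-free; `--supports stmt-QuantumFields-19200 --as helper`, count-neutral.  HONEST LABEL (№33 (6)): curved γ-row supplier line (LOD localisation);
abstract glue; nothing of (3.49), Thm 3.1∕3.3, `h349`, `hGF`, EX ∕ 19200 is proved.

THE POINT.  Print's complementary gauge projector is `P(U) = 1 − R(U)`, `R(U)` the orthogonal projection onto `Δ^η_U N` with `N = ker Q″` ([Balaban1985BackgroundPropagators] (3.21) p.394;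
tree ✓`B11Eq103H1Complex.projR`).  The repaired LOD route (memo §7 (E2)) writes `range P = (Δ N)ᗮ` as the image of the coarse space under the MASSIVE propagator:
for `Δ` symmetric, `T` an adjoint of `Q` (`⟪Qλ, c⟫ = ⟪λ, Tc⟫`) and any scalar `a`,
    `(Δ·ker Q)ᗮ = {f : (Δ + a·T∘Q) f ∈ range T}`                      (§1 `orthogonal_map_ker_eq_comap_range`, no inverse needed)
so that with `G = (Δ + a·TQ)⁻¹` (two-sided inverse as hypotheses) `(Δ·ker Q)ᗮ = range (G ∘ T)` (§1 `orthogonal_map_ker_eq_range_comp`): the columns `G T e_y` SPAN `range P`,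
and ✓p746782 `Prop7ProjRangeKernelDecayCoarseGram` (`P = B(BᴴB)⁻¹Bᴴ` for `B :=` the matrix of `G ∘ T`) IS print's `P`.  §2 is the (L4′)-core: the Gram operator `BᴴB` is coercive
as soon as a (smooth) INTERPOLANT `S` of the coarse data exists with `α‖c‖² ≤ Re⟪Tc, Sc⟫` and `‖(Δ + a·TQ)(Sc)‖ ≤ β‖c‖` — then `α‖c‖ ≤ β‖G(Tc)‖` (one Cauchy–Schwarz through the
symmetry of `Δ + a·TQ`); at the member `S c = Σ_y β_y·c_y` with the smooth transport-dressed bumps of pen (BUMP).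

WHAT IS PROVED (ns `Summit.QuantumFields.YangMills.Theorems.Prop7LODProjectorGlue`; `E`, `F` finite-dimensional complex inner-product spaces).
* §1 `orthogonal_range_le_ker` (`(range T)ᗮ ≤ ker Q`), `orthogonal_ker_le_range` (`(ker Q)ᗮ ≤ range T`), ★★ `orthogonal_map_ker_eq_comap_range`, ★★ `orthogonal_map_ker_eq_range_comp`.
* §2 ★★ `norm_le_norm_inv_adjoint_of_interpolant` (`α‖c‖ ≤ β‖G(Tc)‖`), ★ `sq_norm_le_of_interpolant` (`(α∕β)²‖c‖² ≤ ‖G(Tc)‖²`, the `hcoer` shape of ✓`accretive_gram_of_coercive`).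

References: T. Bałaban, CMP **99** (1985) 389–434 [Balaban1985BackgroundPropagators] ((3.21)–(3.23) p.394, (3.26) p.395, (3.49) p.399); A. Målqvist, D. Peterseim, Math. Comp. **83**
(2014) 2583–2603.
-/

set_option autoImplicit false

noncomputable section

open scoped InnerProductSpace ComplexConjugate

namespace Summit.QuantumFields.YangMills.Theorems.Prop7LODProjectorGlue

variable {E F : Type*} [NormedAddCommGroup E] [InnerProductSpace ℂ E] [NormedAddCommGroup F] [InnerProductSpace ℂ F]

/-! ## §1 `(Δ·ker Q)ᗮ` through the massive operator `Δ + a·TQ` -/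

section Structural

variable (Q : E →ₗ[ℂ] F) (T : F →ₗ[ℂ] E)

/-- `(range T)ᗮ ≤ ker Q` when `T` is an adjoint of `Q` (`⟪Qλ, c⟫ = ⟪λ, Tc⟫`). [cite: Balaban1985BackgroundPropagators, (3.21) p.394] -/
theorem orthogonal_range_le_ker (hT : ∀ (l : E) (c : F), ⟪Q l, c⟫_ℂ = ⟪l, T c⟫_ℂ) : (LinearMap.range T)ᗮ ≤ LinearMap.ker Q := by
  intro v hv
  rw [Submodule.mem_orthogonal] at hv
  rw [LinearMap.mem_ker, ← inner_self_eq_zero (𝕜 := ℂ)]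
  have h := hv (T (Q v)) (LinearMap.mem_range_self T (Q v))
  -- `⟪T(Qv), v⟫ = conj ⟪v, T(Qv)⟫ = conj ⟪Qv, Qv⟫`
  rw [← inner_conj_symm, ← hT v (Q v), map_eq_zero] at h
  exact h

/-- `(ker Q)ᗮ ≤ range T` (finite dimension: `(ker Q)ᗮ ≤ (range T)ᗮᗮ = range T`). [cite: Balaban1985BackgroundPropagators, (3.21) p.394] -/
theorem orthogonal_ker_le_range [FiniteDimensional ℂ E] (hT : ∀ (l : E) (c : F), ⟪Q l, c⟫_ℂ = ⟪l, T c⟫_ℂ) : (LinearMap.ker Q)ᗮ ≤ LinearMap.range T := by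
  have h := Submodule.orthogonal_le (orthogonal_range_le_ker Q T hT)
  rwa [Submodule.orthogonal_orthogonal] at h

/-- ★★ **`(Δ·ker Q)ᗮ = (Δ + a·TQ)⁻¹(range T)` AS A COMAP** (no inverse needed): for `Δ` symmetric and `T` an adjoint of `Q`,
`f ⊥ Δ(ker Q) ↔ (Δ + a·T∘Q) f ∈ range T`. [cite: Balaban1985BackgroundPropagators, (3.21)–(3.26) pp.394–395] -/
theorem orthogonal_map_ker_eq_comap_range [FiniteDimensional ℂ E] (Δ : E →ₗ[ℂ] E) (hΔ : ∀ x y : E, ⟪Δ x, y⟫_ℂ = ⟪x, Δ y⟫_ℂ)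
    (hT : ∀ (l : E) (c : F), ⟪Q l, c⟫_ℂ = ⟪l, T c⟫_ℂ) (a : ℂ) :
    ((LinearMap.ker Q).map Δ)ᗮ = (LinearMap.range T).comap (Δ + a • (T ∘ₗ Q)) := by
  ext f
  rw [Submodule.mem_orthogonal, Submodule.mem_comap]
  constructor
  · intro hf
    -- `Δ f ⊥ ker Q`, hence `Δ f ∈ range T`
    have hΔf : Δ f ∈ (LinearMap.ker Q)ᗮ := by
      rw [Submodule.mem_orthogonal]
      intro l hl
      rw [← hΔ l f]
      exact hf (Δ l) (Submodule.mem_map_of_mem hl)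
    obtain ⟨c, hc⟩ := LinearMap.mem_range.mp (orthogonal_ker_le_range Q T hT hΔf)
    rw [LinearMap.add_apply, LinearMap.smul_apply, LinearMap.comp_apply, ← hc, ← map_smul, ← map_add]
    exact LinearMap.mem_range_self T _
  · intro hf u hu
    obtain ⟨l, hl, rfl⟩ := Submodule.mem_map.mp hu
    obtain ⟨c, hc⟩ := LinearMap.mem_range.mp hf
    rw [LinearMap.add_apply, LinearMap.smul_apply, LinearMap.comp_apply] at hc
    -- `Δ f = T c − a T (Q f) = T (c − a Q f)`
    have hΔf : Δ f = T (c - a • Q f) := by rw [map_sub, map_smul, hc, add_sub_cancel_right]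
    rw [hΔ l f, hΔf, ← hT l, LinearMap.mem_ker.mp hl, inner_zero_left]

/-- ★★ **`(Δ·ker Q)ᗮ = range (G ∘ T)`** when `G` is a two-sided inverse of `Δ + a·TQ`: the columns `G T e_y` (the massive potentials of the coarse profiles) SPAN the range of
print's `P = 1 − R`. [cite: Balaban1985BackgroundPropagators, (3.21)–(3.27) pp.394–395] -/
theorem orthogonal_map_ker_eq_range_comp [FiniteDimensional ℂ E] (Δ G : E →ₗ[ℂ] E) (hΔ : ∀ x y : E, ⟪Δ x, y⟫_ℂ = ⟪x, Δ y⟫_ℂ)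
    (hT : ∀ (l : E) (c : F), ⟪Q l, c⟫_ℂ = ⟪l, T c⟫_ℂ) (a : ℂ)
    (hAG : ∀ v, (Δ + a • (T ∘ₗ Q)) (G v) = v) (hGA : ∀ v, G ((Δ + a • (T ∘ₗ Q)) v) = v) :
    ((LinearMap.ker Q).map Δ)ᗮ = LinearMap.range (G ∘ₗ T) := by
  rw [orthogonal_map_ker_eq_comap_range Q T Δ hΔ hT a]
  ext f
  rw [Submodule.mem_comap, LinearMap.mem_range, LinearMap.mem_range]
  constructor
  · rintro ⟨c, hc⟩
    exact ⟨c, by rw [LinearMap.comp_apply, hc, hGA]⟩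
  · rintro ⟨c, rfl⟩
    exact ⟨c, by rw [LinearMap.comp_apply, hAG]⟩

end Structural

/-! ## §2 (L4′)-core: coercivity of the Gram operator from an interpolant -/

section Interpolant

/-- ★★ **GRAM COERCIVITY FROM AN INTERPOLANT**: `A` symmetric with right inverse `G` (`A (G v) = v`), `T` the coarse-to-fine map; if an interpolant `S` of the coarse data satisfies
`α‖c‖² ≤ Re⟪Tc, Sc⟫` and `‖A(Sc)‖ ≤ β‖c‖`, then `α‖c‖ ≤ β‖G(Tc)‖` (test `G(Tc)` against `A(Sc)`: `⟪G(Tc), A(Sc)⟫ = ⟪A(G(Tc)), Sc⟫ = ⟪Tc, Sc⟫`).  At the member: `A = Δ_U + aQ″†Q″`,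
`T = Q″†`, `S c = Σ_y β_y c_y` (smooth transport-dressed bumps, pen (BUMP)). [cite: Balaban1985BackgroundPropagators, Thm 3.1 p.397] -/
theorem norm_le_norm_inv_adjoint_of_interpolant (A G : E →ₗ[ℂ] E) (hA : ∀ x y : E, ⟪A x, y⟫_ℂ = ⟪x, A y⟫_ℂ) (hAG : ∀ v, A (G v) = v)
    (T S : F →ₗ[ℂ] E) {α β : ℝ} (hβ : 0 ≤ β)
    (hS : ∀ c, α * ‖c‖ ^ 2 ≤ RCLike.re ⟪T c, S c⟫_ℂ) (hAS : ∀ c, ‖A (S c)‖ ≤ β * ‖c‖) (c : F) :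
    α * ‖c‖ ≤ β * ‖G (T c)‖ := by
  have hid : ⟪G (T c), A (S c)⟫_ℂ = ⟪T c, S c⟫_ℂ := by rw [← hA, hAG]
  have h1 : α * ‖c‖ ^ 2 ≤ ‖G (T c)‖ * (β * ‖c‖) := by
    calc α * ‖c‖ ^ 2 ≤ RCLike.re ⟪T c, S c⟫_ℂ := hS c
      _ ≤ ‖⟪T c, S c⟫_ℂ‖ := RCLike.re_le_norm _
      _ = ‖⟪G (T c), A (S c)⟫_ℂ‖ := by rw [hid]
      _ ≤ ‖G (T c)‖ * ‖A (S c)‖ := norm_inner_le_norm _ _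
      _ ≤ ‖G (T c)‖ * (β * ‖c‖) := mul_le_mul_of_nonneg_left (hAS c) (norm_nonneg _)
  by_cases hc : ‖c‖ = 0
  · rw [hc, mul_zero]; positivity
  · have hcpos : 0 < ‖c‖ := lt_of_le_of_ne (norm_nonneg _) (Ne.symm hc)
    have h2 : α * ‖c‖ * ‖c‖ ≤ β * ‖G (T c)‖ * ‖c‖ := by nlinarith
    exact le_of_mul_le_mul_right h2 hcpos

/-- ★ The squared form (the `hcoer` shape of ✓`Prop7ProjRangeKernelDecayCoarseGram.accretive_gram_of_coercive` after passing to matrices): `0 ≤ α`, `0 < β` ⟹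
`(α∕β)²·‖c‖² ≤ ‖G(Tc)‖²`. [cite: Balaban1985BackgroundPropagators, Thm 3.1 p.397] -/
theorem sq_norm_le_of_interpolant (A G : E →ₗ[ℂ] E) (hA : ∀ x y : E, ⟪A x, y⟫_ℂ = ⟪x, A y⟫_ℂ) (hAG : ∀ v, A (G v) = v)
    (T S : F →ₗ[ℂ] E) {α β : ℝ} (hα : 0 ≤ α) (hβ : 0 < β)
    (hS : ∀ c, α * ‖c‖ ^ 2 ≤ RCLike.re ⟪T c, S c⟫_ℂ) (hAS : ∀ c, ‖A (S c)‖ ≤ β * ‖c‖) (c : F) :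
    (α / β) ^ 2 * ‖c‖ ^ 2 ≤ ‖G (T c)‖ ^ 2 := by
  have h := norm_le_norm_inv_adjoint_of_interpolant A G hA hAG T S hβ.le hS hAS c
  have h1 : α / β * ‖c‖ ≤ ‖G (T c)‖ := by
    rw [div_mul_eq_mul_div, div_le_iff₀ hβ]; linarith
  have h0 : 0 ≤ α / β * ‖c‖ := by positivity
  calc (α / β) ^ 2 * ‖c‖ ^ 2 = (α / β * ‖c‖) ^ 2 := by ring
    _ ≤ ‖G (T c)‖ ^ 2 := pow_le_pow_left₀ h0 h1 2

end Interpolant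

end Summit.QuantumFields.YangMills.Theorems.Prop7LODProjectorGlue

end
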